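import Mathlib

/-!
# `Balaban1983to89.B4Eq19CampanatoIterationSharp` — T. Bałaban, *Propagators and renormalization transformations for lattice gauge theories. II*,
# Commun. Math. Phys. **96** (1984) 223–250 [Balaban1984PropagatorsII] (1.9) p. 226, with *Propagators for lattice gauge theories in a background
# field*, Commun. Math. Phys. **99** (1985) 389–434 [Balaban1985BackgroundPropagators] Thm 3.1 (3.43)₁∕(3.44) p. 398: **CAMPANATO's ITERATION LEMMA IN THE
# SHARP FORM `β < α`** ([Giaquinta1984] Ch. III Lemma 2.1 p. 86 with exponents `α = q+1`, `β = q`): from `ψ(P) ≤ A(P∕R)^{q+1}ψ(R) + BR^q` on `[1, R₀]` to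
# `ψ(P) ≤ (4A)^q(P∕R)^qψ(R) + (4∕3)(4A)^{2q}·B·P^q` — the conclusion keeps the exponent `q` of the inhomogeneity (gen 94's `B4Eq19CampanatoIteration` is the
# degenerate case `β = α`, which loses one power and is too weak for the gradient (`C^{1,½}`) iteration of `B4Eq19LatticeGradientCampanato`).

statement-level skeleton of published theorems with citation tags; proofs where landed; nothing here is a claim about the Yang–Mills mass gap

CITATION HEADER (lean-in-tree rule).  Audit cell `pub-balaban`, sub-cell `t4`, BINDER row NE9; filed by NE9 crux-team LEAF PROVER 01
(`b2b-balaban-t4-ne9-formalise-leaf-01`, gen 95; bears_on: R4/N22).  Source for the lemma: [Giaquinta1984] M. Giaquinta, *Multiple integrals in the calculus of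
variations and nonlinear elliptic systems*, Ch. III Lemma 2.1 p. 86 (held: `book:giaquinta1984`); [Balaban1984PropagatorsII] (1.9) ∕ [Balaban1985BackgroundPropagators]
(3.43)₁, (3.44) are the printed statements the `B4Eq19Lattice*` files serve, nothing of them is asserted here.  Pattern: gen 94's `B4Eq19CampanatoIteration`.

WHAT IS PROVED (sorry-free; proof lane — 0 `def`; real-variable, no lattice).
* `iterate_step_sharp` — along `R_k = τ^kR`, `τ = 1∕(4A)`: `ψ(τ^kR) ≤ (τ^k)^q·(ψ(R) + (4∕3)BR^q(4A)^q)` (`Aτ^{q+1} = τ^q∕4`; the inhomogeneity is absorbed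
  because `BR'^q ≤ (3∕4)·τ^q·(τ^k)^q·M` at `R' = τ^kR`).
* **`campanato_iteration_sharp`** — `A ≥ 1`, `B ≥ 0`, `ψ ≥ 0` nondecreasing on `[1,R₀]`, `ψ(P) ≤ A(P∕R)^{q+1}ψ(R) + BR^q` for `1 ≤ P ≤ R ≤ R₀` ⟹
  `ψ(P) ≤ (4A)^q(P∕R)^qψ(R) + (4∕3)(4A)^{2q}BP^q` for `1 ≤ P ≤ R ≤ R₀`.
HONEST SCOPE.  [Giaquinta1984]'s elementary lemma, crude constants; no estimate of print; NOT summit progress (cell pub-balaban: NE9 NOT PRINTED ∕ NOT PROVED; spine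
PROVED 0∕9; finite T⁴ — NOT infinite volume, NOT mass gap, NOT BetaPertH, NOT Clay).  NEW file importing Mathlib only.  Net new unproved facts: 0.
-/

noncomputable section

namespace Literature.MathematicalPhysics.QuantumFieldTheory.Balaban1983to89.B4Eq19CampanatoIterationSharp

/-- **The geometric iteration along `R_k = τ^k R`, `τ = 1∕(4A)`**: if `ψ ≥ 0` on `[1,R₀]` and `ψ(P) ≤ A(P∕R')^{q+1}ψ(R') + B R'^q` for `1 ≤ P ≤ R' ≤ R₀`,
then for every `k` with `τ^k R ≥ 1` (`1 ≤ R ≤ R₀`): `ψ(τ^k R) ≤ (τ^k)^q·(ψ(R) + (4∕3) B R^q (4A)^q)`. [cite: Giaquinta1984, Ch. III Lemma 2.1 p.86] -/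
theorem iterate_step_sharp {ψ : ℝ → ℝ} {A B R₀ : ℝ} {q : ℕ} (hA : 1 ≤ A) (hB : 0 ≤ B)
    (hψ0 : ∀ t, 1 ≤ t → t ≤ R₀ → 0 ≤ ψ t)
    (hyp : ∀ P R, 1 ≤ P → P ≤ R → R ≤ R₀ → ψ P ≤ A * (P / R) ^ (q + 1) * ψ R + B * R ^ q)
    {R : ℝ} (hR1 : 1 ≤ R) (hR : R ≤ R₀) :
    ∀ k : ℕ, 1 ≤ (1 / (4 * A)) ^ k * R →
      ψ ((1 / (4 * A)) ^ k * R) ≤ ((1 / (4 * A)) ^ k) ^ q * (ψ R + 4 / 3 * B * R ^ q * (4 * A) ^ q) := by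
  set τ : ℝ := 1 / (4 * A) with hτ
  have hA0 : 0 < A := by linarith
  have hτ0 : 0 < τ := by rw [hτ]; positivity
  have hτ1 : τ ≤ 1 := by rw [hτ, div_le_one (by positivity)]; linarith
  have hτA : τ * (4 * A) = 1 := by rw [hτ]; field_simp
  have hτinv : (4 * A) ^ q * τ ^ q = 1 := by rw [← mul_pow, mul_comm, hτA, one_pow]
  have hR0 : 0 < R := by linarith
  set M : ℝ := ψ R + 4 / 3 * B * R ^ q * (4 * A) ^ q with hM
  have hψR : 0 ≤ ψ R := hψ0 R hR1 hR
  have hBR : 0 ≤ B * R ^ q * (4 * A) ^ q := by positivity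
  intro k
  induction k with
  | zero =>
    intro _
    simp only [pow_zero, one_mul, one_pow]
    rw [hM]; linarith
  | succ k ih =>
    intro hk1
    have hle : τ ^ (k + 1) * R ≤ τ ^ k * R := by
      rw [pow_succ]
      have : τ ^ k * τ ≤ τ ^ k * 1 := mul_le_mul_of_nonneg_left hτ1 (by positivity)
      nlinarith
    have hk0 : 1 ≤ τ ^ k * R := hk1.trans hle
    have hkR : τ ^ k * R ≤ R := by
      have : τ ^ k ≤ 1 := pow_le_one₀ hτ0.le hτ1
      nlinarith
    have ihk := ih hk0
    have hstep := hyp (τ ^ (k + 1) * R) (τ ^ k * R) hk1 hle (hkR.trans hR)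
    have hratio : τ ^ (k + 1) * R / (τ ^ k * R) = τ := by rw [pow_succ]; field_simp
    rw [hratio] at hstep
    -- `A τ^{q+1} = τ^q/4`
    have hAτ : A * τ ^ (q + 1) = τ ^ q / 4 := by rw [pow_succ, hτ]; field_simp
    have hψk0 : 0 ≤ ψ (τ ^ k * R) := hψ0 _ hk0 (hkR.trans hR)
    -- the inhomogeneity: `B (τ^k R)^q = (τ^k)^q τ^q · (B R^q (4A)^q)`
    have hkey : B * (τ ^ k * R) ^ q = (τ ^ k) ^ q * τ ^ q * (B * R ^ q * (4 * A) ^ q) := by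
      calc B * (τ ^ k * R) ^ q = (τ ^ k) ^ q * (B * R ^ q) * 1 := by rw [mul_pow]; ring
        _ = (τ ^ k) ^ q * (B * R ^ q) * ((4 * A) ^ q * τ ^ q) := by rw [hτinv]
        _ = (τ ^ k) ^ q * τ ^ q * (B * R ^ q * (4 * A) ^ q) := by ring
    have htarget : (τ ^ (k + 1)) ^ q * M = (τ ^ k) ^ q * τ ^ q * M := by rw [pow_succ, mul_pow]
    rw [htarget]
    have hτq0 : 0 ≤ (τ ^ k) ^ q * τ ^ q := by positivity
    calc ψ (τ ^ (k + 1) * R) ≤ A * τ ^ (q + 1) * ψ (τ ^ k * R) + B * (τ ^ k * R) ^ q := hstep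
      _ = τ ^ q / 4 * ψ (τ ^ k * R) + (τ ^ k) ^ q * τ ^ q * (B * R ^ q * (4 * A) ^ q) := by rw [hAτ, hkey]
      _ ≤ τ ^ q / 4 * ((τ ^ k) ^ q * M) + (τ ^ k) ^ q * τ ^ q * (B * R ^ q * (4 * A) ^ q) := by
          have := mul_le_mul_of_nonneg_left ihk (by positivity : (0:ℝ) ≤ τ ^ q / 4)
          linarith
      _ = (τ ^ k) ^ q * τ ^ q * (M / 4 + B * R ^ q * (4 * A) ^ q) := by ring
      _ ≤ (τ ^ k) ^ q * τ ^ q * M := by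
          apply mul_le_mul_of_nonneg_left _ hτq0
          rw [hM]; linarith

/-- **CAMPANATO'S ITERATION LEMMA, SHARP FORM** ([Giaquinta1984] Ch. III Lemma 2.1 with `α = q+1 > β = q`).  Let `A ≥ 1`, `B ≥ 0`, and let `ψ` be nonnegative
and nondecreasing on `[1, R₀]` with `ψ(P) ≤ A (P∕R)^{q+1} ψ(R) + B R^q` whenever `1 ≤ P ≤ R ≤ R₀`.  Then for all `1 ≤ P ≤ R ≤ R₀`:
`ψ(P) ≤ (4A)^q (P∕R)^q ψ(R) + (4∕3)(4A)^{2q} B P^q` — the inhomogeneity keeps its exponent (choose `τ = 1∕(4A)`, iterate along `τ^kR` by `iterate_step_sharp`,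
compare `P` with the nearest `τ^kR ≥ P` by monotonicity, and use `τ^k < (P∕R)∕τ`). [cite: Giaquinta1984, Ch. III Lemma 2.1 p.86; Balaban1984PropagatorsII, (1.9) p.226] -/
theorem campanato_iteration_sharp {ψ : ℝ → ℝ} {A B R₀ : ℝ} {q : ℕ} (hA : 1 ≤ A) (hB : 0 ≤ B)
    (hψ0 : ∀ t, 1 ≤ t → t ≤ R₀ → 0 ≤ ψ t)
    (hmono : ∀ s t, 1 ≤ s → s ≤ t → t ≤ R₀ → ψ s ≤ ψ t)
    (hyp : ∀ P R, 1 ≤ P → P ≤ R → R ≤ R₀ → ψ P ≤ A * (P / R) ^ (q + 1) * ψ R + B * R ^ q) :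
    ∀ P R, 1 ≤ P → P ≤ R → R ≤ R₀ → ψ P ≤ (4 * A) ^ q * (P / R) ^ q * ψ R + 4 / 3 * (4 * A) ^ (2 * q) * B * P ^ q := by
  intro P R hP hPR hR
  set τ : ℝ := 1 / (4 * A) with hτ
  have hA0 : 0 < A := by linarith
  have hτ0 : 0 < τ := by rw [hτ]; positivity
  have hτ1 : τ < 1 := by rw [hτ, div_lt_one (by positivity)]; linarith
  have hτA : τ * (4 * A) = 1 := by rw [hτ]; field_simp
  have hR1 : 1 ≤ R := hP.trans hPR
  have hR0 : 0 < R := by linarith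
  have hP0 : 0 < P := by linarith
  have hψR : 0 ≤ ψ R := hψ0 R hR1 hR
  -- the least `k` with `τ^{k+1} R < P`
  have hex : ∃ k : ℕ, τ ^ (k + 1) * R < P := by
    obtain ⟨n, hn⟩ := exists_pow_lt_of_lt_one (show 0 < P / R by positivity) hτ1
    refine ⟨n, ?_⟩
    rw [lt_div_iff₀ hR0] at hn
    calc τ ^ (n + 1) * R = τ ^ n * R * τ := by rw [pow_succ]; ring
      _ ≤ τ ^ n * R * 1 := mul_le_mul_of_nonneg_left hτ1.le (by positivity)
      _ = τ ^ n * R := mul_one _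
      _ < P := hn
  classical
  let k := Nat.find hex
  have hk : τ ^ (k + 1) * R < P := Nat.find_spec hex
  have hkP : P ≤ τ ^ k * R := by
    by_cases hk0 : k = 0
    · rw [hk0, pow_zero, one_mul]; exact hPR
    · obtain ⟨j, hj⟩ := Nat.exists_eq_succ_of_ne_zero hk0
      have hmin := Nat.find_min hex (show j < k by omega)
      push Not at hmin
      rw [hj]; exact hmin
  have hk1 : 1 ≤ τ ^ k * R := hP.trans hkP
  have hkR : τ ^ k * R ≤ R := by
    have : τ ^ k ≤ 1 := pow_le_one₀ hτ0.le hτ1.le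
    nlinarith
  have hiter := iterate_step_sharp hA hB hψ0 hyp hR1 hR k hk1
  have h1 : ψ P ≤ ψ (τ ^ k * R) := hmono P _ hP hkP (hkR.trans hR)
  -- `τ^k ≤ (P/R)·(4A)`
  have hτk : τ ^ k ≤ P / R * (4 * A) := by
    have h2 : τ ^ k * τ * R < P := by rw [← pow_succ]; exact hk
    have h3 : τ ^ k * R < P * (4 * A) := by
      have := mul_lt_mul_of_pos_right h2 (show (0:ℝ) < 4 * A by positivity)
      calc τ ^ k * R = τ ^ k * R * (τ * (4 * A)) := by rw [hτA, mul_one]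
        _ = τ ^ k * τ * R * (4 * A) := by ring
        _ < P * (4 * A) := this
    rw [div_mul_eq_mul_div, le_div_iff₀ hR0]
    exact h3.le
  have hτkq : (τ ^ k) ^ q ≤ (P / R) ^ q * (4 * A) ^ q := by
    rw [← mul_pow]; exact pow_le_pow_left₀ (by positivity) hτk _
  have hMnn : 0 ≤ ψ R + 4 / 3 * B * R ^ q * (4 * A) ^ q := by positivity
  have hPR' : (P / R) ^ q * R ^ q = P ^ q := by rw [← mul_pow, div_mul_cancel₀ _ hR0.ne']
  calc ψ P ≤ ψ (τ ^ k * R) := h1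
    _ ≤ (τ ^ k) ^ q * (ψ R + 4 / 3 * B * R ^ q * (4 * A) ^ q) := hiter
    _ ≤ ((P / R) ^ q * (4 * A) ^ q) * (ψ R + 4 / 3 * B * R ^ q * (4 * A) ^ q) := mul_le_mul_of_nonneg_right hτkq hMnn
    _ = (4 * A) ^ q * (P / R) ^ q * ψ R + 4 / 3 * ((4 * A) ^ q * (4 * A) ^ q) * B * ((P / R) ^ q * R ^ q) := by ring
    _ = (4 * A) ^ q * (P / R) ^ q * ψ R + 4 / 3 * (4 * A) ^ (2 * q) * B * P ^ q := by rw [hPR', ← pow_add, ← two_mul]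

end Literature.MathematicalPhysics.QuantumFieldTheory.Balaban1983to89.B4Eq19CampanatoIterationSharp

end
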